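import Summits.KontsevichZagierPeriods.KontsevichZagierPeriods.Theses.FurushoPentagon
import Summits.KontsevichZagierPeriods.KontsevichZagierPeriods.Theorems.FurushoPentagonPentagonInKZ
import Literature.NumberTheory.Transcendental.KZLogCalculusProofs

/-!
# Crux `KernelModuloPeriodConjecture` (stmt-KontsevichZagierPeriods-15058) — line `MixedPentagonInKZ`
(forward-rung harvest, unit `fwd-harvest-KontsevichZagierPeriods-01`, 2026-08-17; source seat
`fwd-rung-KontsevichZagierPeriods-01`, rung `CycloPentagonInKZ 2 = MixedPentagonInKZ`, F3 witness
`CycloPentagonInKZ 1` = the proved seed `Summit.KontsevichZagierPeriods.FurushoPentagon.PentagonInKZ.PentagonInKZ_of`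
(stmt-KontsevichZagierPeriods-11348); companion file `Lines/MixedPentagonInKZ_special.lean`, card `Lines/MixedPentagonInKZ.md`)

POSITION ON THE CRUX. The crux (route FurushoPentagon, DECLARED REMAINDER) is
`MzvPeriodConjecture → PentagonInKZ → ReducedPeriodRing → SectorToKernel`; its certified redirect
(SPLIT.md, landed glue `stub_splitGlue : A → O → crux`) has the algebraic leaf
A = `AssociatorHoffmanSpanning` (lines `Sketch`, `genus_zero_funnel`) and the OFF-SECTOR complement
O = `OffMzvSectorComplement` — Conjecture 1 off the multiple-zeta sector (`Disproof.lean` §5: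
`not_stubO_iff : ¬O ↔ MzvSectorKernel ∧ ¬summit`, `stubO_of_summit`). This line is a FORWARD RUNG on
the O side: the level-2 analogue, inside the Kontsevich–Zagier rules, of the route's proved crux
`PentagonInKZ` — the first geometric input on the NEAREST off-MZV sector (level `N = 2`: Euler /
alternating sums, poles `{0, 1, -1}`), exactly parallel to what `PentagonInKZ` supplies on the MZV
sector for the landed transfer `mzvSectorKernel_of`. It does NOT conclude the crux: the passage
rung → (level-2 sector kernel) → O needs the level-2 distribution/octagon relations in the rules, a
level-2 spanning theorem (Deligne 2010, `N = 2`) and the period conjecture for `MT(ℤ[1/2])` — the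
ladder is CAPPED there (source bc9: `ladder_ceiling=capped-at-MotivicRelationsInKZ`,
`Literature/Barriers/KontsevichZagierPeriods/GrothendieckPeriodConjectureDependence.lean`; disp=frontier).
By the rung-harvest protocol the composition proved in this file concludes the RUNG by name
(`MixedPentagonInKZ_of`), from three registered stubs; no new route, no new crux.

THE RUNG `MixedPentagonInKZ` (copied VERBATIM from the source seat's `Sketch.lean`, rc 0 there): in every
realisation `χ` of the rules over a commutative `ℚ`-algebra `R`, every level-2 series
`Ψ ∈ R⟨⟨X₀,X₁,X₋₁⟩⟩` that is group-like, vanishes on the two divergent letters and agrees with `χ` of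
the level-2 simplex representation `[{1 > t₀ > ⋯ > t_{n-1} > 0}, ∏ᵢ (tᵢ - σ(wᵢ))⁻¹]`, `σ = (0, 1, -1)`, on
convergent words satisfies, with the floor's series `Φ_χ`, Enriquez's MIXED PENTAGON
`h^{1,2,34} h^{12,3,4} = g^{2,3,4} h^{1,23,4} h^{1,2,3}` (Enriquez–Furusho, arXiv:1103.1188, §3 Def. 3.3)
in every algebra receiving Kohno generators of the arrangement
`𝒜₂ = {x=0, x=1, x=-1, y=0, y=1, y=-1, x=y, x=-y}` (validated numerically by the source seat to
weight 4, residual 9e-16; dims 8/49/272/1441).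

REGISTERED STUBS (sorries live ONLY here):
* `stub_eulerSimplexReps` — **E** (size M, analysis): the level-2 simplex representations EXIST — a
  family `J w : KZ.IntegralRep |w|` with domain the open ordered simplex and integrand
  `∏ᵢ (tᵢ - σ(wᵢ))⁻¹` on it, for every convergent word (`head ≠ 1`, `last ≠ 0`). Content: `ℚ`-semialgebraicity
  of the rational integrand and absolute integrability on the simplex (domination by an admissible MZV
  integrand, `KZ.mzvIntegrand_integrableOn_holds`; `|1/(t+1)| ≤ 1 ≤ 1/t, 1/(1-t)` on `(0,1)`). Not covered by
  the floor's `PathFamilies.exists_rep` (there the poles `≠ 0` are separated from `[0, β]`; here pole `1`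
  touches the simplex).
* `stub_regUnique3` — **U** (size M, algebra): UNIQUENESS of two-sided shuffle regularisation over the
  three-letter alphabet: two group-like series on `Fin 3` over a `ℚ`-algebra that agree on the letters `0`,
  `1` and on every nonempty convergent word are equal (`𝔥_ш = 𝔥⁰_ш[x₁, x₀]`, Ihara–Kaneko–Zagier 2006
  Prop. 1 / Reutenauer, *Free Lie algebras* §6 — alphabet-agnostic; the tree has only the `Bool` regularisation
  `MZV.shuffleReg` and the one-sided `Shuffle.regFront/regEnd`).
* `stub_mixedPentagonHolonomy` — **H** (size XL, geometry; THE LOAD-BEARING STUB): for every such family `J`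
  and every realisation `χ` (with `Z` pinned to the MZV simplex classes, so that `Φ_χ` is the floor's series
  verbatim) there EXISTS a group-like `Ψ`, zero on the letters `0`, `1`, equal to `χ [J w]` on nonempty
  convergent words, satisfying the mixed pentagon identity. Intended proof = the floor's proof of
  `PentagonInKZ` one level up (cell-Stokes on the blown-up cell `0 < x < y < 1` of `𝒜₂`: sides `x = 0`,
  `y = 1`, exceptional divisor at `(1,1)` (alphabet `{0,1}` → the factor `Φ(e 6, e 4)`), `x = y`, exceptional
  divisor at the multiplicity-4 corner `(0,0)` (alphabet `{0,1,-1}`)); every half-edge chart has pole row in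
  `{0, 1, -1, 2}` with tangential base point `0` and endpoint `1/2`, i.e. the regime of the landed
  `PathFamilies.exists_rep`, `ShuffleProduct.shuffle_dissection` (any `β`, any pole row `s : Fin 3 → ℝ`),
  `HalfEdgeUniversal`, `Corner*` files of `Theorems/FurushoPentagonPentagonInKZ*.lean`; new supports needed:
  existence half of `𝔥_ш = 𝔥⁰_ш[x₁,x₀]` on `Fin 3` (a level-2 `shuffleReg`), level-2 dissection on the unit
  simplex for CONVERGENT words (the in-tree `shuffle_dissection` at `β = 1` asks reps for head-`1` words, which
  do not exist), 3-slot half-edge identities, the multiplicity-4 corner principle, telescoping in `A`.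
  [cite: EnriquezFurusho2012, Def. 3.3]; [cite: Enriquez2007, §1].

COMPOSITION (proved, no sorry): `mixedPentagonInKZ_of_stubs : E → U → H → MixedPentagonInKZ` — take `J`
from E and `Ψ₀` from H; the crux's `Ψ` agrees with `Ψ₀` on nonempty convergent words by CONGRUENCE inside
the rules (`KZ.of_sub_of_mem_relations_of_eqOn`: same domain, integrands equal on it ⇒ `[r] - [J w] ∈
KZ.relations`, killed by `χ`), on the letters `0`, `1` (both zero) — so `Ψ = Ψ₀` by U, and H's identity is
the goal. `MixedPentagonInKZ_of : MixedPentagonInKZ` and `cycloPentagonInKZ_two : CycloPentagonInKZ 2`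
then follow from the stubs BY NAME.

DISPROOF USED (`Cruxes/KernelModuloPeriodConjecture/Disproof.lean`): §4 records that the crux has NO
`_false_without_` theorem (`not_withoutZ_iff`/`not_withoutP_iff`/`not_withoutR_iff`: each needs `¬summit`);
§5 `not_stubO_iff`, `stubO_of_summit` place this line: it works on O's side, where only a disproof of
Conjecture 1 off the MZV sector can kill anything; the Stub-A mutations (`stubA_false_without_pentagon`,
`not_stubAIntegral`, `not_stubADepthCompatible`) concern the algebraic leaf and are not touched. No stub
here is an instance of a landed Negative lemma (`Theorems/KernelModuloPeriodConjecture/Negative/Anatomy.lean`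
`iff_summit_of_hyps` concerns the crux's own hypotheses).

FORWARD: rung_decl=Summit.KontsevichZagierPeriods.KontsevichZagierPeriods.Cruxes.KernelModuloPeriodConjecture.CycloPentagon.MixedPentagonInKZ;
family=…CycloPentagon.CycloPentagonInKZ; witness=Summit.KontsevichZagierPeriods.FurushoPentagon.PentagonInKZ.PentagonInKZ_of
(`CycloPentagonInKZ 1`, file Lines/MixedPentagonInKZ_special.lean); floor item stmt-KontsevichZagierPeriods-11348.

References: B. Enriquez, H. Furusho, *Mixed pentagon, octagon and Broadhurst duality equations*,
J. Pure Appl. Algebra 216 (2012), arXiv:1103.1188, §3 Def. 3.3; B. Enriquez, *Quasi-reflection algebras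
and cyclotomic associators*, Selecta Math. 13 (2007) §1; V. Drinfeld, Leningrad Math. J. 2 (1991) §2;
K. Ihara, M. Kaneko, D. Zagier, Compos. Math. 142 (2006) Prop. 1; P. Deligne, *Le groupe fondamental
unipotent motivique de `G_m - μ_N` pour `N = 2,3,4,6` ou `8`*, Publ. IHÉS 112 (2010);
M. Kontsevich, D. Zagier, *Periods* (2001) §1.2.
-/

noncomputable section

set_option linter.dupNamespace false

namespace Summit.KontsevichZagierPeriods.KontsevichZagierPeriods.Cruxes.KernelModuloPeriodConjecture.CycloPentagon

open Literature.NumberTheory.Transcendental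
open Summit.KontsevichZagierPeriods.KontsevichZagierPeriods.Theses

/-! ## The rung and its graded family (verbatim from the source seat's `Sketch.lean`) -/

/-- crux (rank 2) — **the level-2 mixed pentagon inside the KZ rules** (next rung above
`FurushoPentagon.PentagonInKZ`: one level lifted, `ℙ¹∖{0,1,∞}` ↦ `ℙ¹∖{0,±1,∞}`). For every
commutative `ℚ`-algebra `R`, every realisation `χ` of the rules (additive, killing `KZ.relations`,
multiplicative, unital), every `Z` pinned to the MZV simplex classes (so that `Φ_χ` below is the
floor's series verbatim) and every level-2 series `Ψ : R⟨⟨Fin 3⟩⟩` which is group-like, vanishes on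
the divergent letters `0` (`dt/t`) and `1` (`dt/(t-1)`), and whose coefficient of every convergent word
`w` (nonempty, `head ≠ 1`, `last ≠ 0`; leftmost letter outermost) is `χ` of the simplex
representation `[{1 > t₀ > ⋯ > t_{n-1} > 0}, ∏ᵢ (tᵢ - σ(wᵢ))⁻¹]`, `σ = (0, 1, -1)`: for every
`R`-algebra `A`, elements `e : Fin 8 → A` (↔ the lines `x=0, x=1, x=-1, y=0, y=1, y=-1, x=y, x=-y`)
with all products of `m+1` of them zero and satisfying Kohno's relations
`[e_i, Σ_{j ∈ S} e_j] = 0` (`i ∈ S`) for the nine affine multiple points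
`S ∈ {(0,0)↦{0,3,6,7}, (1,1)↦{1,4,6}, (-1,-1)↦{2,5,6}, (1,-1)↦{1,5,7}, (-1,1)↦{2,4,7}, (0,1)↦{0,4},
(0,-1)↦{0,5}, (1,0)↦{1,3}, (-1,0)↦{2,3}}` (= Enriquez's presentation of `𝔱⁰₄,₂` under
`e 0 ↦ t¹², e 3 ↦ t¹³, e 6 ↦ t(0)²³, e 7 ↦ t(1)²³, e 1 ↦ t(0)²⁴, e 2 ↦ t(1)²⁴, e 4 ↦ t(0)³⁴,
e 5 ↦ t(1)³⁴`), Enriquez's MIXED PENTAGON EQUATION `h^{1,2,34} h^{12,3,4} = g^{2,3,4} h^{1,23,4} h^{1,2,3}`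
(Enriquez–Furusho 2012, Def. 3.3 (mixed pentagon-GRTM), insertion maps of §3) holds VERBATIM for
`(g, h) = (Φ_χ, Ψ)`:
`Ψ(e 0, e 1 + e 6, e 2 + e 7) · Ψ(e 3 + e 6 + e 7, e 4, e 5)
   = Φ(e 6, e 4) · Ψ(e 0 + e 3 + e 6 + e 7, e 1 + e 4, e 2 + e 5) · Ψ(e 0, e 6, e 7)` in `A`
(`Φ(a,b) = NCSeries.subst₂ m Φ a b`, `Ψ(a,b,c) = NCSeries.evalTrunc m ![a,b,c] Ψ`).  Numerically
validated to weight 4 (folder numerics/, residual 9e-16 in the 1441-dimensional weight-4 quotient).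
[cite: EnriquezFurusho2012, Def. 3.3]; [cite: Enriquez2007, §1]; [cite: Drinfeld1991, §2] -/
def MixedPentagonInKZ : Prop :=
  ∀ (R : Type) [CommRing R] [Algebra ℚ R] (χ : KZ.FormalRep →+ R),
    (∀ c ∈ KZ.relations, χ c = 0) →
    (∀ a b : KZ.FormalRep, χ (a * b) = χ a * χ b) →
    (∃ u : KZ.FormalRep, χ u = 1) →
    ∀ Z : List ℕ → KZ.FormalRep,
      (∀ (u : List ℕ) (hu : MZV.IsAdmissible u),
        Z u = KZ.of (KZ.mzvRep u hu (KZ.mzvIntegrand_isSemialgebraicFunOn_holds u)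
          (KZ.mzvIntegrand_integrableOn_holds u hu))) →
    ∀ Ψ : NCSeries (Fin 3) R,
      NCSeries.IsGroupLike Ψ → Ψ [0] = 0 → Ψ [1] = 0 →
      (∀ w : List (Fin 3), w ≠ [] → w.head? ≠ some 1 → w.getLast? ≠ some 0 →
        ∃ r : KZ.IntegralRep w.length,
          r.domain = KZ.openOrderedSimplex w.length ∧
          Set.EqOn r.integrand
            (fun t => ∏ i : Fin w.length, (t i - (![(0 : ℝ), 1, -1] : Fin 3 → ℝ) (w.get i))⁻¹)
            r.domain ∧
          Ψ w = χ (KZ.of r)) →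
      ∀ (A : Type) [Ring A] [Algebra R A] (e : Fin 8 → A) (m : ℕ),
        (∀ f : Fin (m + 1) → Fin 8, ((List.ofFn f).map e).prod = 0) →
        (∀ S ∈ ([[0, 3, 6, 7], [1, 4, 6], [2, 5, 6], [1, 5, 7], [2, 4, 7], [0, 4], [0, 5], [1, 3],
            [2, 3]] : List (List (Fin 8))), ∀ i ∈ S, Commute (e i) (S.map e).sum) →
        NCSeries.evalTrunc m ![e 0, e 1 + e 6, e 2 + e 7] Ψ *
            NCSeries.evalTrunc m ![e 3 + e 6 + e 7, e 4, e 5] Ψ =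
          NCSeries.subst₂ m
                (fun W : List Bool => (-1 : R) ^ (W.count true) *
                  (MZV.shuffleReg W).sum (fun v a => a • (if MZV.IsConvergentWord v then
                    χ (Z (MZV.ofBinaryWord v)) else (0 : R))))
                (e 6) (e 4) *
              NCSeries.evalTrunc m ![e 0 + e 3 + e 6 + e 7, e 1 + e 4, e 2 + e 5] Ψ *
            NCSeries.evalTrunc m ![e 0, e 6, e 7] Ψ

/-- The graded family (LEVEL `N` of the cyclotomic pentagon inside the rules), typed for
`N ∈ {1, 2}`: level 1 is the floor `FurushoPentagon.PentagonInKZ` VERBATIM (the tree's level-1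
objects — `Bool` words, `DrinfeldKohnoTrunc R (Fin 4)`, `MZV.shuffleReg` — are not syntactic
instances of the level-`N` interface; the interface form at `N = 1` is equivalent to the floor by the
universal property of `U𝔞₄` and uniqueness of shuffle regularisation), level 2 is
`MixedPentagonInKZ`; levels `N ≥ 3` have complex poles `μ_N` and are not typed (the family is
`False` there, i.e. makes no claim). [cite: Enriquez2007, §1] -/
def CycloPentagonInKZ (N : ℕ) : Prop :=
  (N = 1 ∨ N = 2) ∧ (N = 1 → FurushoPentagon.PentagonInKZ) ∧ (N = 2 → MixedPentagonInKZ)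

/-- Level 1 of the family is literally the floor. -/
theorem cycloPentagonInKZ_one_iff : CycloPentagonInKZ 1 ↔ FurushoPentagon.PentagonInKZ := by
  simp [CycloPentagonInKZ]

/-- Level 2 of the family is the rung. -/
theorem cycloPentagonInKZ_two_iff : CycloPentagonInKZ 2 ↔ MixedPentagonInKZ := by
  simp [CycloPentagonInKZ]

/-! ## F3 witness: level 1 of the family is the proved floor (sorry-free; also standalone in
`Lines/MixedPentagonInKZ_special.lean`) -/

/-- **Level 1 of the family is the floor, proved** — closed by the seed
`Summit.KontsevichZagierPeriods.FurushoPentagon.PentagonInKZ.PentagonInKZ_of`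
(stmt-KontsevichZagierPeriods-11348). [folklore] -/
theorem cycloPentagonInKZ_one : CycloPentagonInKZ 1 :=
  ⟨Or.inl rfl, fun _ => Summit.KontsevichZagierPeriods.FurushoPentagon.PentagonInKZ.PentagonInKZ_of,
    fun h => absurd h (by decide)⟩

/-! ## Registered stubs -/

/-- **E — the level-2 simplex representations exist** (size M, analysis). For every word `w` over
`Fin 3` that is convergent (`head ≠ 1`, `last ≠ 0`; the empty word included, with the empty product)
there is an integral representation of the rules with domain the open ordered simplex
`{1 > t₀ > ⋯ > t_{n-1} > 0}` and integrand `∏ᵢ (tᵢ - σ(wᵢ))⁻¹`, `σ = (0, 1, -1)`, on it — packaged as one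
family `J` (its values on divergent words are irrelevant). Content: `ℚ`-semialgebraicity of the rational
integrand and absolute integrability (domination by an admissible multiple-zeta integrand).
[cite: KontsevichZagier2001, §1.1]; [cite: Enriquez2007, §1] -/
theorem stub_eulerSimplexReps :
    ∃ J : (w : List (Fin 3)) → KZ.IntegralRep w.length,
      (∀ w : List (Fin 3), w.head? ≠ some 1 → w.getLast? ≠ some 0 →
        (J w).domain = KZ.openOrderedSimplex w.length ∧
        Set.EqOn (J w).integrand
          (fun t => ∏ i : Fin w.length, (t i - (![(0 : ℝ), 1, -1] : Fin 3 → ℝ) (w.get i))⁻¹)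
          (J w).domain) := by
  sorry

/-- **U — uniqueness of two-sided shuffle regularisation over three letters** (size M, algebra). Two
group-like series `Ψ, Ψ' : R⟨⟨Fin 3⟩⟩` over a commutative `ℚ`-algebra which agree on the letters `0` and
`1` and on every nonempty convergent word (`head ≠ 1`, `last ≠ 0`) are equal: the shuffle algebra on
`{x₀, x₁, x₋₁}` is the polynomial algebra `𝔥⁰_ш[x₁, x₀]` over the convergent words (Ihara–Kaneko–Zagier
2006, Prop. 1, whose proof is alphabet-agnostic; Reutenauer, *Free Lie algebras*, §6). Only the
uniqueness half is needed here. [cite: IharaKanekoZagier2006, Prop. 1] -/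
theorem stub_regUnique3 :
    ∀ (R : Type) [CommRing R] [Algebra ℚ R] (Ψ Ψ' : NCSeries (Fin 3) R),
      NCSeries.IsGroupLike Ψ → NCSeries.IsGroupLike Ψ' → Ψ [0] = Ψ' [0] → Ψ [1] = Ψ' [1] →
      (∀ w : List (Fin 3), w ≠ [] → w.head? ≠ some 1 → w.getLast? ≠ some 0 → Ψ w = Ψ' w) →
      Ψ = Ψ' := by
  sorry

/-- **H — the regularised level-2 holonomy satisfies the mixed pentagon** (size XL, geometry; the
load-bearing stub). For every family `J` of level-2 simplex representations (as in E) and every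
realisation `χ` of the rules (`Z` pinned to the MZV simplex classes, so that `Φ_χ` below is the floor's
series verbatim) there EXISTS a level-2 series `Ψ` — group-like, zero on the divergent letters `0`, `1`,
equal to `χ [J w]` on nonempty convergent words — satisfying Enriquez's mixed pentagon
`Ψ(e 0, e 1 + e 6, e 2 + e 7) · Ψ(e 3 + e 6 + e 7, e 4, e 5)
   = Φ_χ(e 6, e 4) · Ψ(e 0 + e 3 + e 6 + e 7, e 1 + e 4, e 2 + e 5) · Ψ(e 0, e 6, e 7)`
in every `R`-algebra `A` with Kohno generators `e : Fin 8 → A` of `𝒜₂` nilpotent beyond weight `m`.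
Intended proof: the floor's cell-Stokes proof of `PentagonInKZ` one level up, around the blown-up cell
`0 < x < y < 1` of `𝒜₂` (five sides; exceptional alphabets `{0,1}` at `(1,1)` and `{0,1,-1}` at the
multiplicity-4 corner `(0,0)`), all half-edge charts in the regime of the landed `PathFamilies.exists_rep`
and `ShuffleProduct.shuffle_dissection`; plus the existence half of `𝔥_ш = 𝔥⁰_ш[x₁,x₀]` on `Fin 3`.
[cite: EnriquezFurusho2012, Def. 3.3]; [cite: Enriquez2007, §1]; [cite: Drinfeld1991, §2] -/
theorem stub_mixedPentagonHolonomy :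
    ∀ J : (w : List (Fin 3)) → KZ.IntegralRep w.length,
      (∀ w : List (Fin 3), w.head? ≠ some 1 → w.getLast? ≠ some 0 →
        (J w).domain = KZ.openOrderedSimplex w.length ∧
        Set.EqOn (J w).integrand
          (fun t => ∏ i : Fin w.length, (t i - (![(0 : ℝ), 1, -1] : Fin 3 → ℝ) (w.get i))⁻¹)
          (J w).domain) →
      ∀ (R : Type) [CommRing R] [Algebra ℚ R] (χ : KZ.FormalRep →+ R),
        (∀ c ∈ KZ.relations, χ c = 0) →
        (∀ a b : KZ.FormalRep, χ (a * b) = χ a * χ b) →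
        (∃ u : KZ.FormalRep, χ u = 1) →
        ∀ Z : List ℕ → KZ.FormalRep,
          (∀ (u : List ℕ) (hu : MZV.IsAdmissible u),
            Z u = KZ.of (KZ.mzvRep u hu (KZ.mzvIntegrand_isSemialgebraicFunOn_holds u)
              (KZ.mzvIntegrand_integrableOn_holds u hu))) →
        ∃ Ψ : NCSeries (Fin 3) R,
          NCSeries.IsGroupLike Ψ ∧ Ψ [0] = 0 ∧ Ψ [1] = 0 ∧
          (∀ w : List (Fin 3), w ≠ [] → w.head? ≠ some 1 → w.getLast? ≠ some 0 →
            Ψ w = χ (KZ.of (J w))) ∧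
          ∀ (A : Type) [Ring A] [Algebra R A] (e : Fin 8 → A) (m : ℕ),
          (∀ f : Fin (m + 1) → Fin 8, ((List.ofFn f).map e).prod = 0) →
          (∀ S ∈ ([[0, 3, 6, 7], [1, 4, 6], [2, 5, 6], [1, 5, 7], [2, 4, 7], [0, 4], [0, 5], [1, 3],
              [2, 3]] : List (List (Fin 8))), ∀ i ∈ S, Commute (e i) (S.map e).sum) →
          NCSeries.evalTrunc m ![e 0, e 1 + e 6, e 2 + e 7] Ψ *
              NCSeries.evalTrunc m ![e 3 + e 6 + e 7, e 4, e 5] Ψ =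
            NCSeries.subst₂ m
                  (fun W : List Bool => (-1 : R) ^ (W.count true) *
                    (MZV.shuffleReg W).sum (fun v a => a • (if MZV.IsConvergentWord v then
                      χ (Z (MZV.ofBinaryWord v)) else (0 : R))))
                  (e 6) (e 4) *
                NCSeries.evalTrunc m ![e 0 + e 3 + e 6 + e 7, e 1 + e 4, e 2 + e 5] Ψ *
              NCSeries.evalTrunc m ![e 0, e 6, e 7] Ψ := by
  sorry

/-! ## Composition (proved) -/

/-- **Congruence inside the rules**: two representations with the open-simplex domain whose integrands
agree with the same function on it have the same class in every realisation killing `KZ.relations`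
(integrand additivity with a zero representation, `KZ.of_sub_of_mem_relations_of_eqOn`).
[cite: KontsevichZagier2001, §1.2] -/
theorem chi_of_eq_of_eqOn {R : Type} [CommRing R] (χ : KZ.FormalRep →+ R)
    (hrel : ∀ c ∈ KZ.relations, χ c = 0) {n : ℕ} {r r' : KZ.IntegralRep n} {F : (Fin n → ℝ) → ℝ}
    (hd : r.domain = KZ.openOrderedSimplex n) (hF : Set.EqOn r.integrand F r.domain)
    (hd' : r'.domain = KZ.openOrderedSimplex n) (hF' : Set.EqOn r'.integrand F r'.domain) :
    χ (KZ.of r) = χ (KZ.of r') := by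
  have hdd : r'.domain = r.domain := by rw [hd, hd']
  have hEq : Set.EqOn r.integrand r'.integrand r.domain := by
    intro x hx
    have hx' : x ∈ r'.domain := by rw [hdd]; exact hx
    rw [hF hx, hF' hx']
  have h0 : χ (KZ.of r - KZ.of r') = 0 := hrel _ (KZ.of_sub_of_mem_relations_of_eqOn hdd hEq)
  rwa [map_sub, sub_eq_zero] at h0

/-- **The rung from the three stubs** (E, U, H as hypotheses; no sorry): `J` from E, `Ψ₀` from H; the
crux's `Ψ` agrees with `Ψ₀` on the letters `0`, `1` and — by congruence inside the rules — on every
nonempty convergent word, hence `Ψ = Ψ₀` by U, and H's identity is the goal. [folklore] -/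
theorem mixedPentagonInKZ_of_stubs
    (hE : ∃ J : (w : List (Fin 3)) → KZ.IntegralRep w.length,
      (∀ w : List (Fin 3), w.head? ≠ some 1 → w.getLast? ≠ some 0 →
        (J w).domain = KZ.openOrderedSimplex w.length ∧
        Set.EqOn (J w).integrand
          (fun t => ∏ i : Fin w.length, (t i - (![(0 : ℝ), 1, -1] : Fin 3 → ℝ) (w.get i))⁻¹)
          (J w).domain))
    (hU : ∀ (R : Type) [CommRing R] [Algebra ℚ R] (Ψ Ψ' : NCSeries (Fin 3) R),
      NCSeries.IsGroupLike Ψ → NCSeries.IsGroupLike Ψ' → Ψ [0] = Ψ' [0] → Ψ [1] = Ψ' [1] →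
      (∀ w : List (Fin 3), w ≠ [] → w.head? ≠ some 1 → w.getLast? ≠ some 0 → Ψ w = Ψ' w) →
      Ψ = Ψ')
    (hH : ∀ J : (w : List (Fin 3)) → KZ.IntegralRep w.length,
      (∀ w : List (Fin 3), w.head? ≠ some 1 → w.getLast? ≠ some 0 →
        (J w).domain = KZ.openOrderedSimplex w.length ∧
        Set.EqOn (J w).integrand
          (fun t => ∏ i : Fin w.length, (t i - (![(0 : ℝ), 1, -1] : Fin 3 → ℝ) (w.get i))⁻¹)
          (J w).domain) →
      ∀ (R : Type) [CommRing R] [Algebra ℚ R] (χ : KZ.FormalRep →+ R),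
        (∀ c ∈ KZ.relations, χ c = 0) →
        (∀ a b : KZ.FormalRep, χ (a * b) = χ a * χ b) →
        (∃ u : KZ.FormalRep, χ u = 1) →
        ∀ Z : List ℕ → KZ.FormalRep,
          (∀ (u : List ℕ) (hu : MZV.IsAdmissible u),
            Z u = KZ.of (KZ.mzvRep u hu (KZ.mzvIntegrand_isSemialgebraicFunOn_holds u)
              (KZ.mzvIntegrand_integrableOn_holds u hu))) →
        ∃ Ψ : NCSeries (Fin 3) R,
          NCSeries.IsGroupLike Ψ ∧ Ψ [0] = 0 ∧ Ψ [1] = 0 ∧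
          (∀ w : List (Fin 3), w ≠ [] → w.head? ≠ some 1 → w.getLast? ≠ some 0 →
            Ψ w = χ (KZ.of (J w))) ∧
          ∀ (A : Type) [Ring A] [Algebra R A] (e : Fin 8 → A) (m : ℕ),
          (∀ f : Fin (m + 1) → Fin 8, ((List.ofFn f).map e).prod = 0) →
          (∀ S ∈ ([[0, 3, 6, 7], [1, 4, 6], [2, 5, 6], [1, 5, 7], [2, 4, 7], [0, 4], [0, 5], [1, 3],
              [2, 3]] : List (List (Fin 8))), ∀ i ∈ S, Commute (e i) (S.map e).sum) →
          NCSeries.evalTrunc m ![e 0, e 1 + e 6, e 2 + e 7] Ψ *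
              NCSeries.evalTrunc m ![e 3 + e 6 + e 7, e 4, e 5] Ψ =
            NCSeries.subst₂ m
                  (fun W : List Bool => (-1 : R) ^ (W.count true) *
                    (MZV.shuffleReg W).sum (fun v a => a • (if MZV.IsConvergentWord v then
                      χ (Z (MZV.ofBinaryWord v)) else (0 : R))))
                  (e 6) (e 4) *
                NCSeries.evalTrunc m ![e 0 + e 3 + e 6 + e 7, e 1 + e 4, e 2 + e 5] Ψ *
              NCSeries.evalTrunc m ![e 0, e 6, e 7] Ψ) :
    MixedPentagonInKZ := by
  intro R _ _ χ hrel hmul hunit Z hZ Ψ hG h0 h1 hconv A _ _ e m hnil hK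
  obtain ⟨J, hJ⟩ := hE
  obtain ⟨Ψ₀, hG₀, h00, h01, hpin, hid⟩ := hH J hJ R χ hrel hmul hunit Z hZ
  have hΨ : Ψ = Ψ₀ := by
    refine hU R Ψ Ψ₀ hG hG₀ (by rw [h0, h00]) (by rw [h1, h01]) ?_
    intro w hw hh hl
    obtain ⟨r, hrd, hrF, hrw⟩ := hconv w hw hh hl
    obtain ⟨hJd, hJF⟩ := hJ w hh hl
    rw [hrw, hpin w hw hh hl]
    exact chi_of_eq_of_eqOn χ hrel hrd hrF hJd hJF
  subst hΨ
  exact hid A e m hnil hK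

/-- **`MixedPentagonInKZ` from the registered stubs, by name.** [folklore] -/
theorem MixedPentagonInKZ_of : MixedPentagonInKZ :=
  mixedPentagonInKZ_of_stubs stub_eulerSimplexReps stub_regUnique3 stub_mixedPentagonHolonomy

/-- Level 2 of the graded family, from the stubs by name (level 1 is the proved floor, see
`Lines/MixedPentagonInKZ_special.lean`). [folklore] -/
theorem cycloPentagonInKZ_two : CycloPentagonInKZ 2 :=
  cycloPentagonInKZ_two_iff.mpr MixedPentagonInKZ_of

end Summit.KontsevichZagierPeriods.KontsevichZagierPeriods.Cruxes.KernelModuloPeriodConjecture.CycloPentagon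

end
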